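import Literature.NumberTheory.EllipticCurves.ComplexMultiplicationCoatesWiles
import Literature.NumberTheory.EllipticCurves.LatticeJInvariant
import Literature.NumberTheory.EllipticCurves.ModularCurveNeronLatticeProofs
import Mathlib.AlgebraicGeometry.EllipticCurve.ModelsWithJ
import HarnessLib

/-!
# CM periods from singular moduli: the period lattice of a CM curve is `Ω · 𝓞_K`

Topic `NumberTheory/EllipticCurves`; level 3 of the decomposition of the named fact
`Literature.NumberTheory.EllipticCurves.finite_point_of_j_mem_maximalCMJInvariants_of_L_one_ne_zero` (= Coates–Wiles 1977,
Thm. 1 for `F = ℚ`, composed with Mordell–Weil; `Literature/…/ComplexMultiplication.lean`).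
Level 2 (`Literature/…/ComplexMultiplicationCoatesWiles.lean`) reduced it to three named facts,
one of which is the CM-period leaf

* `Literature.NumberTheory.EllipticCurves.exists_isCMPeriod_of_j_mem_maximalCMJInvariants` : for `E/ℚ` with
  `j(E) ∈ maximalCMJInvariants` the period lattice `L` of `ω_E` is `Ω · 𝓞_K`, `K = ℚ(√d)`,
  `d = cmDiscr (j E)` (Coates–Wiles 1977, §1 p. 225: "we can choose `Ω ∈ L` such that `L = Ω𝓞`").

Here this leaf is **reduced to the classical table of singular moduli** and everything else is
proved.  With `τ_d = ω_d = (d + √d)/2 ∈ ℍ` (`Literature.NumberTheory.EllipticCurves.cmTau`) and the period pair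
`Λ_d = (ω_d, 1)` (`Literature.NumberTheory.EllipticCurves.cmPeriodPair`, lattice `ℤω_d + ℤ = ℤ[ω_d] = 𝓞_K`,
`Literature.NumberTheory.EllipticCurves.coe_cmPeriodPair_lattice`):

* `Literature.NumberTheory.EllipticCurves.singularModuli_classNumberOne` (named fact): `j(𝓞_K) = j(Λ_d)` is the tabulated
  integer for each of the nine class-number-one fields, i.e. `j(Λ_{d(j)}) = j` for
  `j ∈ maximalCMJInvariants` — Cox, *Primes of the form x² + ny²*, §12.C, table (12.20):
  `d = −4 ↦ 12³`, `−7 ↦ −15³`, `−8 ↦ 20³`, `−11 ↦ −32³`, `−19 ↦ −96³`, `−43 ↦ −960³`,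
  `−67 ↦ −5280³`, `−163 ↦ −640320³`, and `d = −3 ↦ 0`;
* `Literature.NumberTheory.EllipticCurves.j_cmPeriodPair_neg_four`, `Literature.NumberTheory.EllipticCurves.j_cmPeriodPair_neg_three` (proved): the two rows
  `j(ℤ[i]) = 1728`, `j(ℤ[ρ]) = 0` (Cox §10.C; `PeriodPair.j_ofUpperHalfPlane_I`,
  `PeriodPair.j_ofUpperHalfPlane_ρ` of `LatticeJInvariant.lean`), and
  `Literature.NumberTheory.EllipticCurves.singularModuli_classNumberOne_of_seven` : the fact follows from its seven remaining
  rows;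
* `Literature.NumberTheory.EllipticCurves.exists_isCMPeriod_of_j_cmPeriodPair_eq` (proved): if `j(Λ_{d(j(E))}) = j(E)` then
  `E` has a CM period — by the Uniformization Theorem (`Literature.NumberTheory.EllipticCurves.ModularForms.exists_isNeronLatticeOf_holds`)
  there is a Néron lattice `L` with `j(L) = j(E)` (`PeriodPair.j_eq_weierstrassCurve_j`), by
  Cox Thm. 10.9 (`PeriodPair.exists_lattice_eq_mulLeft_of_j_eq`, which rests on
  `PeriodPair.uniformization_unique_holds`) `L = Ω Λ_d = Ω 𝓞_K`;
* `Literature.NumberTheory.EllipticCurves.exists_isCMPeriod_of_j_eq_zero`, `Literature.NumberTheory.EllipticCurves.exists_isCMPeriod_of_j_eq_1728` (proved,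
  unconditional) and
  `Literature.NumberTheory.EllipticCurves.exists_isCMPeriod_of_j_mem_maximalCMJInvariants_of_singularModuli` : the CM-period
  leaf from the singular-moduli fact;
* `Literature.NumberTheory.EllipticCurves.j_cmPeriodPair_eq_of_isCMPeriod`, `Literature.NumberTheory.EllipticCurves.singularModuli_classNumberOne_iff`
  (proved): conversely a CM period of `E` gives the row `j(Λ_{d(j(E))}) = j(E)`, and since every
  `j ∈ ℚ` is the `j`-invariant of a curve over `ℚ` (Mathlib `WeierstrassCurve.ofJ`) the
  singular-moduli fact is **equivalent** to the CM-period leaf — the reduction loses nothing;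
* `Literature.NumberTheory.EllipticCurves.CoatesWiles1977_L_one_eq_zero_of_not_isOfFinAddOrder_of_singularModuli`,
  `Literature.NumberTheory.EllipticCurves.finite_point_of_j_mem_maximalCMJInvariants_of_L_one_ne_zero_of_singularModuli` :
  Coates–Wiles Thm. 1 (`F = ℚ`) and the target fact from the `𝔭`-divisibility fact
  `CoatesWiles1977_L_one_div_period_mem_prime`, Deuring's `a_p = π + π̄`
  (`Deuring1941_frobeniusTrace_eq_add_conj`) and the seven singular moduli.

Design notes.  `cmTau d` needs `d < 0` to land in `ℍ`; it is made total by the junk value `i`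
for `d ≥ 0` (never used: all statements concern `d ∈ cmDiscrs`).  Cox tabulates `j(τ₀)` for
`τ₀ = i, √−2, (3 + √−m)/2`; since `[1, τ₀] = [1, ω_d] = 𝓞_K` and `j` only depends on the lattice
(`PeriodPair.j_eq_of_lattice_eq`), `j(Λ_d) = j(τ₀) = j(𝓞_K)`, so the fact states exactly the
printed table.  `j(Λ_d) = E₄(τ_d)³/Δ(τ_d)` (`Literature.NumberTheory.EllipticCurves.j_cmPeriodPair_eq`) expresses it through
Mathlib's level-one modular forms, which is the route of Cox's proof (§12.C, (12.21)–(12.23):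
`γ₂ = ∛j` via Weber functions and `q`-expansion estimates); those numerics are not in Mathlib.

## References

* J. Coates, A. Wiles, *On the conjecture of Birch and Swinnerton-Dyer*, Invent. Math. 39 (1977),
  223–251, §1 p. 225.
* D. A. Cox, *Primes of the form x² + ny²*, 2nd ed., Wiley 2013, §7.A eq. (7.1) (`𝓞_K = [1, w_K]`,
  `w_K = (d_K + √d_K)/2`), §10.B–C (eq. (10.8), Thm. 10.9, `j(i) = 1728`, `j(ω) = 0`), §12.C
  table (12.20) (PDF pp. 266–267 of the held 2013 copy; the table body is legible in the 2022
  AMS Chelsea reprint, PDF p. 285, same numbering).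
* K. Rubin, *Elliptic curves with complex multiplication and the conjecture of Birch and
  Swinnerton-Dyer*, LNM 1716 (1999), §7.4.
* J. H. Silverman, *Advanced Topics in the Arithmetic of Elliptic Curves*, GTM 151, App. A §3.
-/

noncomputable section

open scoped UpperHalfPlane
open Complex WeierstrassCurve

namespace Literature.NumberTheory.EllipticCurves

/-! ### The CM points `τ_d = ω_d ∈ ℍ` and the lattices `Λ_d = [ω_d, 1] = 𝓞_K` -/

/-- `Re ω_d = d/2`. [folklore] -/
lemma cmGen_re (d : ℤ) : (cmGen d).re = (d : ℝ) / 2 := by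
  have h2 : (2 : ℂ) * cmGen d = (d : ℂ) + Complex.I * (Real.sqrt (-(d : ℝ)) : ℂ) := by
    simp only [cmGen]; ring
  have := congrArg Complex.re h2
  simp at this
  linarith

/-- `Im ω_d = √|d| / 2` (for `d ≤ 0`; `Real.sqrt` vanishes on negatives, so the formula reads
`Im ω_d = √(−d)/2` for all `d`). [folklore] -/
lemma cmGen_im (d : ℤ) : (cmGen d).im = Real.sqrt (-(d : ℝ)) / 2 := by
  have h2 : (2 : ℂ) * cmGen d = (d : ℂ) + Complex.I * (Real.sqrt (-(d : ℝ)) : ℂ) := by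
    simp only [cmGen]; ring
  have := congrArg Complex.im h2
  simp at this
  linarith

/-- `Im ω_d > 0` for `d < 0`. [folklore] -/
lemma cmGen_im_pos {d : ℤ} (hd : d < 0) : 0 < (cmGen d).im := by
  rw [cmGen_im]
  have : (0 : ℝ) < -(d : ℝ) := by exact_mod_cast neg_pos.mpr hd
  exact div_pos (Real.sqrt_pos.mpr this) two_pos

/-- The CM point `τ_d = ω_d = (d + √d)/2` of the upper half plane, `d < 0` (Cox, (7.1):
`w_K = (d_K + √d_K)/2`; the point `τ₀` of Cox's table (12.20) spans the same lattice
`[1, τ₀] = [1, ω_d]`).  Junk value `i` for `d ≥ 0` (totality; never used). [folklore] -/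
def cmTau (d : ℤ) : ℍ :=
  if hd : d < 0 then ⟨cmGen d, cmGen_im_pos hd⟩ else UpperHalfPlane.I

/-- `τ_d = ω_d` as a complex number, for `d < 0`. [folklore] -/
@[simp] lemma coe_cmTau {d : ℤ} (hd : d < 0) : (cmTau d : ℂ) = cmGen d := by
  rw [cmTau, dif_pos hd]

/-- The period pair `Λ_d = (ω_d, 1)` spanning the lattice `ℤω_d + ℤ = [1, w_K] = 𝓞_K`
(`coe_cmPeriodPair_lattice`), Cox (7.1); the lattice whose `j`-invariant is the singular modulus
`j(𝓞_K)` of table (12.20). [folklore] -/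
def cmPeriodPair (d : ℤ) : PeriodPair :=
  PeriodPair.ofUpperHalfPlane (cmTau d)

/-- First period of `Λ_d` is `ω_d` (`d < 0`). [folklore] -/
@[simp] lemma cmPeriodPair_ω₁ {d : ℤ} (hd : d < 0) : (cmPeriodPair d).ω₁ = cmGen d := by
  rw [cmPeriodPair, PeriodPair.ofUpperHalfPlane_ω₁, coe_cmTau hd]

/-- Second period of `Λ_d` is `1`. [folklore] -/
@[simp] lemma cmPeriodPair_ω₂ (d : ℤ) : (cmPeriodPair d).ω₂ = 1 := rfl

/-- **`Λ_d = 𝓞_K`**: for `d < 0`, `d ≡ 0, 1 (mod 4)` (`4c = d(d−1)`) the lattice `ℤω_d + ℤ`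
spanned by `cmPeriodPair d` is the order `ℤ[ω_d] = {a + bω_d}` (`cmRing d`, `mem_cmRing_iff`);
for the nine class-number-one discriminants this is the ring of integers `𝓞_K` embedded in `ℂ`
(Cox, (5.14), (7.1)). [cite: Cox2013, §7.A eq. (7.1)] -/
theorem coe_cmPeriodPair_lattice {d c : ℤ} (hd : d < 0) (hc : d * (d - 1) = 4 * c) :
    ((cmPeriodPair d).lattice : Set ℂ) = (cmRing d : Set ℂ) := by
  ext x
  rw [SetLike.mem_coe, SetLike.mem_coe, PeriodPair.mem_lattice, mem_cmRing_iff hd.le hc,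
    cmPeriodPair_ω₁ hd, cmPeriodPair_ω₂]
  constructor
  · rintro ⟨m, n, h⟩
    exact ⟨n, m, by rw [← h]; ring⟩
  · rintro ⟨a, b, h⟩
    exact ⟨b, a, by rw [h]; ring⟩

/-- `j(Λ_d) = E₄(τ_d)³ / Δ(τ_d)`: the `j`-invariant of `Λ_d` is the value of the modular
invariant `j = E₄³/Δ` at the CM point `τ_d` (`PeriodPair.j_ofUpperHalfPlane`); this is the form
in which Cox §12.C computes the table (12.20) (`γ₂(τ₀) = ∛j(τ₀)` by `q`-expansions).
[cite: Cox2013, §11.A and §12.C] -/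
theorem j_cmPeriodPair_eq (d : ℤ) :
    (cmPeriodPair d).j = ModularForm.E₄ (cmTau d) ^ 3 / ModularForm.discriminant (cmTau d) :=
  PeriodPair.j_ofUpperHalfPlane _

/-! ### The named fact: singular moduli of the class-number-one maximal orders -/

/-- **Singular moduli of the nine imaginary quadratic orders `𝓞_K` of class number one** (Cox,
*Primes of the form x² + ny²*, §12.C, table (12.20), with `j(𝓞_K) = j(τ₀) = γ₂(τ₀)³`):

| `d_K` | `j(𝓞_K)` |
|---|---|
| `−3` | `0` |
| `−4` | `12³ = 1728` |
| `−7` | `−15³ = −3375` |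
| `−8` | `20³ = 8000` |
| `−11` | `−32³ = −32768` |
| `−19` | `−96³ = −884736` |
| `−43` | `−960³ = −884736000` |
| `−67` | `−5280³ = −147197952000` |
| `−163` | `−640320³ = −262537412640768000` |

stated as: for every `j ∈ maximalCMJInvariants` (the right-hand column, `ComplexMultiplication.lean`)
the lattice `Λ_d = [ω_d, 1] = 𝓞_K`, `d = cmDiscr j` (the left-hand column), has `j(Λ_d) = j`
(`PeriodPair.j`, Cox (10.8); `j` of a lattice only depends on the lattice, and
`[1, τ₀] = [1, ω_d]` for Cox's `τ₀ = i, √−2, (3 + √−m)/2`).  Cox proves the table from the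
integrality of `γ₂(τ₀)` (Thm. 12.2) and the estimates (12.21)–(12.23) on the `q`-expansion of
`γ₂` via Weber functions; the rows `d = −3, −4` are elementary (`j_cmPeriodPair_neg_three`,
`j_cmPeriodPair_neg_four`) and the fact reduces to the other seven
(`singularModuli_classNumberOne_of_seven`).  It is equivalent to the CM-period leaf
`exists_isCMPeriod_of_j_mem_maximalCMJInvariants` (`singularModuli_classNumberOne_iff`).
Not in Mathlib (no `q`-expansion numerics for `j`, no integrality of singular moduli).
[cite: Cox2013, §12.C table (12.20)] -/
def singularModuli_classNumberOne : Prop :=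
  ∀ j ∈ maximalCMJInvariants, (cmPeriodPair (cmDiscr j)).j = (j : ℂ)

/-! ### The two elementary rows: `j(ℤ[i]) = 1728`, `j(ℤ[ρ]) = 0` -/

/-- `√4 = 2`. [folklore] -/
lemma sqrt_four : Real.sqrt 4 = 2 := by
  rw [show (4 : ℝ) = 2 ^ 2 by norm_num, Real.sqrt_sq (by norm_num : (0 : ℝ) ≤ 2)]

/-- `ω_{−4} = (−4 + √−4)/2 = −2 + i`. [folklore] -/
lemma cmGen_neg_four : cmGen (-4) = -2 + Complex.I := by
  have h : Real.sqrt (-((-4 : ℤ) : ℝ)) = 2 := by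
    rw [show (-((-4 : ℤ) : ℝ)) = 4 by norm_num, sqrt_four]
  simp only [cmGen, h]
  push_cast
  ring

/-- `[ω_{−4}, 1] = [−2 + i, 1] = ℤ[i] = Λ_i`. [folklore] -/
theorem cmPeriodPair_neg_four_lattice :
    (cmPeriodPair (-4)).lattice = (PeriodPair.ofUpperHalfPlane UpperHalfPlane.I).lattice := by
  ext x
  simp only [PeriodPair.mem_lattice, cmPeriodPair_ω₁ (show (-4 : ℤ) < 0 by norm_num),
    cmPeriodPair_ω₂, cmGen_neg_four, PeriodPair.ofUpperHalfPlane_ω₁,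
    PeriodPair.ofUpperHalfPlane_ω₂, UpperHalfPlane.coe_I]
  constructor
  · rintro ⟨m, n, h⟩
    exact ⟨m, n - 2 * m, by rw [← h]; push_cast; ring⟩
  · rintro ⟨m, n, h⟩
    exact ⟨m, n + 2 * m, by rw [← h]; push_cast; ring⟩

/-- **Row `d = −4` of table (12.20): `j(ℤ[i]) = j(i) = 1728 = 12³`** (Cox §10.C: `iL = L` forces
`g₃(L) = 0`), proved via `PeriodPair.j_ofUpperHalfPlane_I`.
[cite: Cox2013, §12.C table (12.20) row d_K = -4 and §10.C] -/
theorem j_cmPeriodPair_neg_four : (cmPeriodPair (-4)).j = 1728 := by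
  rw [PeriodPair.j_eq_of_lattice_eq cmPeriodPair_neg_four_lattice, PeriodPair.j_ofUpperHalfPlane_I]

/-- `ρ = (−1 + √−3)/2` as a complex number (Mathlib `UpperHalfPlane.ρ`). [folklore] -/
lemma coe_ρ : (UpperHalfPlane.ρ : ℂ) = ⟨-1 / 2, Real.sqrt 3 / 2⟩ := rfl

/-- `ω_{−3} = (−3 + √−3)/2 = ρ − 1`. [folklore] -/
lemma cmGen_neg_three : cmGen (-3) = (UpperHalfPlane.ρ : ℂ) - 1 := by
  apply Complex.ext
  · rw [cmGen_re, coe_ρ, Complex.sub_re, Complex.one_re]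
    norm_num
  · rw [cmGen_im, coe_ρ, Complex.sub_im, Complex.one_im]
    norm_num

/-- `[ω_{−3}, 1] = [ρ − 1, 1] = ℤ[ρ] = Λ_ρ`. [folklore] -/
theorem cmPeriodPair_neg_three_lattice :
    (cmPeriodPair (-3)).lattice = (PeriodPair.ofUpperHalfPlane UpperHalfPlane.ρ).lattice := by
  ext x
  simp only [PeriodPair.mem_lattice, cmPeriodPair_ω₁ (show (-3 : ℤ) < 0 by norm_num),
    cmPeriodPair_ω₂, cmGen_neg_three, PeriodPair.ofUpperHalfPlane_ω₁,
    PeriodPair.ofUpperHalfPlane_ω₂]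
  constructor
  · rintro ⟨m, n, h⟩
    exact ⟨m, n - m, by rw [← h]; push_cast; ring⟩
  · rintro ⟨m, n, h⟩
    exact ⟨m, n + m, by rw [← h]; push_cast; ring⟩

/-- **Row `d = −3` of table (12.20): `j(ℤ[ρ]) = j(ρ) = 0`** (Cox §10.C and Exercise 10.17:
`ρL = L` forces `g₂(L) = 0`), proved via `PeriodPair.j_ofUpperHalfPlane_ρ`.
[cite: Cox2013, §12.C table (12.20) row d_K = -3 and §10.C] -/
theorem j_cmPeriodPair_neg_three : (cmPeriodPair (-3)).j = 0 := by
  rw [PeriodPair.j_eq_of_lattice_eq cmPeriodPair_neg_three_lattice, PeriodPair.j_ofUpperHalfPlane_ρ]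

/-- `cmDiscr 0 = −3` (table lookup). [folklore] -/
lemma cmDiscr_zero : cmDiscr 0 = -3 := by norm_num [cmDiscr]

/-- `cmDiscr 1728 = −4` (table lookup). [folklore] -/
lemma cmDiscr_1728 : cmDiscr 1728 = -4 := by norm_num [cmDiscr]

/-- **The singular-moduli fact reduces to its seven non-elementary rows** (`d = −7, −8, −11, −19,
−43, −67, −163`), the rows `d = −3, −4` being `j_cmPeriodPair_neg_three`,
`j_cmPeriodPair_neg_four`. [cite: Cox2013, §12.C table (12.20)] -/
theorem singularModuli_classNumberOne_of_seven
    (h : ∀ j ∈ ({-3375, 8000, -32768, -884736, -884736000, -147197952000,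
      -262537412640768000} : Finset ℚ), (cmPeriodPair (cmDiscr j)).j = (j : ℂ)) :
    singularModuli_classNumberOne := by
  intro j hj
  simp only [maximalCMJInvariants, Finset.mem_insert, Finset.mem_singleton] at hj
  rcases hj with rfl | rfl | rfl | rfl | rfl | rfl | rfl | rfl | rfl
  · rw [cmDiscr_zero, j_cmPeriodPair_neg_three]; norm_num
  · rw [cmDiscr_1728, j_cmPeriodPair_neg_four]; norm_num
  all_goals exact h _ (by simp)

/-! ### CM periods from singular moduli (Coates–Wiles §1 p. 225: `L = Ω𝓞`) -/

/-- **The period lattice of a CM curve is `Ω · 𝓞_K`, given its singular modulus.**  Let `E/ℚ`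
have `j(E) ∈ maximalCMJInvariants`, `d = cmDiscr (j E)`, and assume the row `j(Λ_d) = j(E)` of
table (12.20).  By the Uniformization Theorem (`Literature.NumberTheory.EllipticCurves.ModularForms.exists_isNeronLatticeOf_holds`,
Silverman AEC VI.5.1) `E/ℂ` has a Néron lattice `L` (`g₂ = c₄/12`, `g₃ = c₆/216`), and
`j(L) = j(E)` (`PeriodPair.j_eq_weierstrassCurve_j`); so `j(L) = j(Λ_d)` and by Cox Thm. 10.9
(`PeriodPair.exists_lattice_eq_mulLeft_of_j_eq`, resting on the uniqueness half
`PeriodPair.uniformization_unique_holds`) `L = Ω Λ_d = Ω 𝓞_K` for some `Ω ∈ ℂˣ`, i.e.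
`IsCMPeriod E Ω` — the normalisation "`L = Ω𝓞`" of Coates–Wiles §1 p. 225 / Rubin §7.4.
[cite: CoatesWiles1977, §1 p. 225] -/
theorem exists_isCMPeriod_of_j_cmPeriodPair_eq (W : WeierstrassCurve ℚ) [W.IsElliptic]
    (hj : W.j ∈ maximalCMJInvariants) (hJ : (cmPeriodPair (cmDiscr W.j)).j = (W.j : ℂ)) :
    ∃ Ω : ℂ, IsCMPeriod W Ω := by
  obtain ⟨hdneg, c, hc⟩ := neg_and_exists_of_mem_cmDiscrs (cmDiscr_mem_cmDiscrs hj)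
  haveI : (W.baseChange ℂ).IsElliptic := by rw [WeierstrassCurve.baseChange]; infer_instance
  obtain ⟨L, hL⟩ := Literature.NumberTheory.EllipticCurves.ModularForms.exists_isNeronLatticeOf_holds (W.baseChange ℂ)
  have hjV : (W.baseChange ℂ).j = (W.j : ℂ) := by
    simp only [WeierstrassCurve.baseChange, WeierstrassCurve.map_j, eq_ratCast]
  have hjL : L.j = (W.j : ℂ) := by
    rw [PeriodPair.j_eq_weierstrassCurve_j hL.1 hL.2, hjV]
  have hJ' : (cmPeriodPair (cmDiscr W.j)).j = L.j := by rw [hjL]; exact hJ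
  obtain ⟨Ω, hΩ0, hlat⟩ := PeriodPair.exists_lattice_eq_mulLeft_of_j_eq hJ'
  refine ⟨Ω, L, hL, ?_⟩
  rw [hlat]
  ext x
  rw [SetLike.mem_coe, PeriodPair.mem_mulLeft_lattice, ← SetLike.mem_coe,
    coe_cmPeriodPair_lattice hdneg hc, SetLike.mem_coe, Set.mem_image]
  constructor
  · intro h
    exact ⟨Ω⁻¹ * x, h, by rw [← mul_assoc, mul_inv_cancel₀ hΩ0, one_mul]⟩
  · rintro ⟨y, hy, rfl⟩
    rwa [← mul_assoc, inv_mul_cancel₀ hΩ0, one_mul]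

/-- **CM periods for `j = 0`, unconditionally**: an elliptic curve `E/ℚ` with `j(E) = 0` has
period lattice `Ω · ℤ[ρ]` for some `Ω` (row `d = −3` is proved).
[cite: CoatesWiles1977, §1 p. 225] -/
theorem exists_isCMPeriod_of_j_eq_zero (W : WeierstrassCurve ℚ) [W.IsElliptic] (h : W.j = 0) :
    ∃ Ω : ℂ, IsCMPeriod W Ω := by
  refine exists_isCMPeriod_of_j_cmPeriodPair_eq W (by rw [h]; simp [maximalCMJInvariants]) ?_
  rw [h, cmDiscr_zero, j_cmPeriodPair_neg_three]
  norm_num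

/-- **CM periods for `j = 1728`, unconditionally**: an elliptic curve `E/ℚ` with `j(E) = 1728`
has period lattice `Ω · ℤ[i]` for some `Ω` (row `d = −4` is proved).
[cite: CoatesWiles1977, §1 p. 225] -/
theorem exists_isCMPeriod_of_j_eq_1728 (W : WeierstrassCurve ℚ) [W.IsElliptic]
    (h : W.j = 1728) : ∃ Ω : ℂ, IsCMPeriod W Ω := by
  refine exists_isCMPeriod_of_j_cmPeriodPair_eq W (by rw [h]; simp [maximalCMJInvariants]) ?_
  rw [h, cmDiscr_1728, j_cmPeriodPair_neg_four]
  norm_num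

/-- **The CM-period leaf from the singular moduli**: the named fact
`exists_isCMPeriod_of_j_mem_maximalCMJInvariants` (Coates–Wiles §1 p. 225, `L = Ω𝓞`) follows
from the table (12.20) of singular moduli (`singularModuli_classNumberOne`), the Uniformization
Theorem and Cox Thm. 10.9 (all proved). [cite: CoatesWiles1977, §1 p. 225] -/
theorem exists_isCMPeriod_of_j_mem_maximalCMJInvariants_of_singularModuli
    (hS : singularModuli_classNumberOne) : exists_isCMPeriod_of_j_mem_maximalCMJInvariants := by
  intro W _ hj
  exact exists_isCMPeriod_of_j_cmPeriodPair_eq W hj (hS W.j hj)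

/-- **Conversely, a CM period yields the singular modulus**: if `E/ℚ` with
`j(E) ∈ maximalCMJInvariants` has a CM period `Ω` (`IsCMPeriod E Ω`: a Néron lattice
`L = Ω · ℤ[ω_d]`, `d = cmDiscr (j E)`), then `Ω ≠ 0`, `L = Ω Λ_d` and
`j(Λ_d) = j(Ω Λ_d) = j(L) = j(E)` (`PeriodPair.j_mulLeft`, `PeriodPair.j_eq_weierstrassCurve_j`).
[cite: Cox2013, Thm. 10.9] -/
theorem j_cmPeriodPair_eq_of_isCMPeriod (W : WeierstrassCurve ℚ) [W.IsElliptic]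
    (hj : W.j ∈ maximalCMJInvariants) {Ω : ℂ} (hΩ : IsCMPeriod W Ω) :
    (cmPeriodPair (cmDiscr W.j)).j = (W.j : ℂ) := by
  obtain ⟨hdneg, c, hc⟩ := neg_and_exists_of_mem_cmDiscrs (cmDiscr_mem_cmDiscrs hj)
  obtain ⟨L, hL, hlat⟩ := hΩ
  haveI : (W.baseChange ℂ).IsElliptic := by rw [WeierstrassCurve.baseChange]; infer_instance
  have hjV : (W.baseChange ℂ).j = (W.j : ℂ) := by
    simp only [WeierstrassCurve.baseChange, WeierstrassCurve.map_j, eq_ratCast]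
  have hω₁ : L.ω₁ ≠ 0 := by simpa using L.indep.ne_zero 0
  have hΩ0 : Ω ≠ 0 := by
    rintro rfl
    have h1 : L.ω₁ ∈ (L.lattice : Set ℂ) := L.ω₁_mem_lattice
    rw [hlat] at h1
    obtain ⟨y, -, hy⟩ := h1
    simp only [zero_mul] at hy
    exact hω₁ hy.symm
  have hLΛ : L.lattice = ((cmPeriodPair (cmDiscr W.j)).mulLeft Ω hΩ0).lattice := by
    ext x
    have hx : x ∈ L.lattice ↔ x ∈ (L.lattice : Set ℂ) := Iff.rfl
    rw [hx, hlat, Set.mem_image, PeriodPair.mem_mulLeft_lattice, ← SetLike.mem_coe,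
      coe_cmPeriodPair_lattice hdneg hc]
    constructor
    · rintro ⟨y, hy, rfl⟩
      rwa [← mul_assoc, inv_mul_cancel₀ hΩ0, one_mul]
    · intro h
      exact ⟨Ω⁻¹ * x, h, by rw [← mul_assoc, mul_inv_cancel₀ hΩ0, one_mul]⟩
  rw [← hjV, ← PeriodPair.j_eq_weierstrassCurve_j hL.1 hL.2, PeriodPair.j_eq_of_lattice_eq hLΛ,
    PeriodPair.j_mulLeft]

/-- **The table of singular moduli is equivalent to the CM-period leaf.**  Every `j ∈ ℚ` is the
`j`-invariant of an elliptic curve over `ℚ` (Mathlib `WeierstrassCurve.ofJ`, `ofJ_j`), so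
`exists_isCMPeriod_of_j_mem_maximalCMJInvariants` applied to `ofJ j`, `j ∈ maximalCMJInvariants`,
returns each row of table (12.20) (`j_cmPeriodPair_eq_of_isCMPeriod`); the other direction is
`exists_isCMPeriod_of_j_mem_maximalCMJInvariants_of_singularModuli`.  Hence vendoring the table
instead of the period leaf loses nothing. [cite: Cox2013, §12.C table (12.20)] -/
theorem singularModuli_classNumberOne_iff :
    singularModuli_classNumberOne ↔ exists_isCMPeriod_of_j_mem_maximalCMJInvariants := by
  refine ⟨exists_isCMPeriod_of_j_mem_maximalCMJInvariants_of_singularModuli, fun h j hj ↦ ?_⟩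
  have hj' : (WeierstrassCurve.ofJ j).j ∈ maximalCMJInvariants := by
    rwa [WeierstrassCurve.ofJ_j]
  obtain ⟨Ω, hΩ⟩ := h (WeierstrassCurve.ofJ j) hj'
  have := j_cmPeriodPair_eq_of_isCMPeriod (WeierstrassCurve.ofJ j) hj' hΩ
  rwa [WeierstrassCurve.ofJ_j] at this

/-! ### Assembly: Coates–Wiles Thm. 1 (`F = ℚ`) and the target fact from F1, F3 and the table -/

/-- **Coates–Wiles 1977, Theorem 1 (`F = ℚ`) from the `𝔭`-divisibility fact, Deuring's
`a_p = π + π̄` and the seven singular moduli.**  The printed statement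
`CoatesWiles1977_L_one_eq_zero_of_not_isOfFinAddOrder` follows from
`CoatesWiles1977_L_one_div_period_mem_prime` (`h1`, Coates–Wiles §6 p. 250),
`Deuring1941_frobeniusTrace_eq_add_conj` (`h2`, Cox Thm. 14.16) and
`singularModuli_classNumberOne` (`hS`, Cox table (12.20)), via
`CoatesWiles1977_L_one_eq_zero_of_not_isOfFinAddOrder_of_facts` and
`exists_isCMPeriod_of_j_mem_maximalCMJInvariants_of_singularModuli`.
[cite: CoatesWiles1977, Thm 1 (p. 223)] -/
theorem CoatesWiles1977_L_one_eq_zero_of_not_isOfFinAddOrder_of_singularModuli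
    (h1 : CoatesWiles1977_L_one_div_period_mem_prime)
    (h2 : Deuring1941_frobeniusTrace_eq_add_conj)
    (hS : singularModuli_classNumberOne) :
    CoatesWiles1977_L_one_eq_zero_of_not_isOfFinAddOrder :=
  CoatesWiles1977_L_one_eq_zero_of_not_isOfFinAddOrder_of_facts h1 h2
    (exists_isCMPeriod_of_j_mem_maximalCMJInvariants_of_singularModuli hS)

/-- **bsd.S28 (Mordell–Weil part, maximal-order CM) from F1, F3 and the table of singular
moduli**: the target fact `finite_point_of_j_mem_maximalCMJInvariants_of_L_one_ne_zero`
(`L(E, 1) ≠ 0 ⇒ E(ℚ)` finite, for `j(E) ∈ maximalCMJInvariants`) follows from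
`CoatesWiles1977_L_one_div_period_mem_prime`, `Deuring1941_frobeniusTrace_eq_add_conj` and
`singularModuli_classNumberOne`; the period leaf, the Mordell–Weil leaf
(`WeierstrassCurve.module_finite_point_holds`), the split non-anomalous primes and the closing
norm argument are all proved. [cite: CoatesWiles1977, Thm 1 (p. 223)] -/
theorem finite_point_of_j_mem_maximalCMJInvariants_of_L_one_ne_zero_of_singularModuli
    (h1 : CoatesWiles1977_L_one_div_period_mem_prime)
    (h2 : Deuring1941_frobeniusTrace_eq_add_conj)
    (hS : singularModuli_classNumberOne) :
    finite_point_of_j_mem_maximalCMJInvariants_of_L_one_ne_zero :=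
  finite_point_of_j_mem_maximalCMJInvariants_of_L_one_ne_zero_of_mem_prime h1 h2
    (exists_isCMPeriod_of_j_mem_maximalCMJInvariants_of_singularModuli hS)

end Literature.NumberTheory.EllipticCurves

end
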